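import Summits.CriticalPhenomena.PercolationContinuityZ3.Theorems.Transplant.KNCellsBoxProdZ2ConcRootReal
import Summits.CriticalPhenomena.PercolationContinuityZ3.Theorems.Transplant.BoxProdZ2StepKits
import HarnessLib

/-!
# Design (D), residue (R), FINAL RAW FORM for the schedule of record: **`rootOblA_concGB`** — `RootOblA` for
# `concSchemeG X C w₀ (concRadiiGB C gap gap' E₀ L') q δc` with the root tube `B(w₀, F 1 - L')`, the four radius facts discharged
# (`root_radii_concRadiiGB`), and the STANDARD FIRST HOP (p3-g2 15:34Z) discharged arithmetically: seed prism of the frame `γ` at `w₀`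
# (`γ w₀ ∈ V₀`) centred at the planar point `rootV du t m` (signed level `20t - m - 1`, transverse `-3t`; `m = msel (γ w₀)`), hop of scale
# `6t` onto the start row `ca = 26t - m - 1`, `cb = 0`, `q' = 3t` of the planar root run; `RootRunOK` from `r = 4t`, `R' + ℓ₀ ≤ t`,
# `100 R' ≤ t`, `M + 47 R' + 2 ≤ t`

builds on p205010 (kernel theorem, internal audit signed; external expert review pending) — nothing in this file uses p205010.
Lane `prim-bschramm`, seat `prim-bschramm-p2` ((R), lead g3 16:14:18Z (3)); helper file (`--supports stmt-CriticalPhenomena-4575`).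

Remaining hypotheses (history-free; constants/inequalities/inputs only — the (R) block of HOME/prim-bschramm-stmt/CONC-PARAMS.md): numerics
`C.r = 4t`, `R' + ℓ₀ ≤ t`, `100 R' ≤ t`, `M + 47R' + 2 ≤ t`, `Rlev + 1 ≤ R'`, `j₁ ≤ Rlev`, `M + 1 ≤ j₀`, `M < ℓ₀`; counts `hcount/hN/hk` at `δr 44`;
inputs at `q`: `hstd` (scale `M`), `hlink` (scales `[ℓ₀, t + R']`), `hlink₆` (scale `6t`), accuracy `(δr 44)²`; fibre radii `ψ M ≤ E₀`,
`ψ(6t) ≤ E₀`, `E₀ ≤ F 1 - L'`, `ψ(t + R') + ψ M ≤ L' ≤ F 1 - L'`; excess radius `R₁ ≤ F 1 - L' - L'` at `q` for entrances at `E₀ + 1`; `η ≤ δr 44 / 2`.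
* `rootV`, `sgUnit`, `rootτ`; `rootRunOK_std`; `root_piece_subset_core`, `root_seed_subset_Q`, `root_hop_subset_rootU`; **`rootOblA_concGB`**.
[cite: KozmaNitzan2024, §4 p. 27 (G₀), p. 28 ((32) at the root), Lemma 11 (pp. 22–23)]
-/

noncomputable section

open MeasureTheory ProbabilityTheory
open scoped ENNReal Classical

namespace Summit.CriticalPhenomena.PercolationContinuityZ3.Theorems

namespace Transplant

namespace BoxProdZ2

open Literature.Probability.Percolation Literature.Probability.LatticeModels SimpleGraph GadgetSystem ProbeHistory HSiteScheme Contour KNCells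
open Literature.Probability.Percolation.KozmaNitzan
open Literature.Probability.Percolation.KozmaNitzan.Cells (oth oth_ne eq_oth_of_ne sgOf sgOf_sign)
open Literature.Probability.Percolation.GM
open Literature.Barriers.CriticalPhenomena (mem_graphBall_self)
open KNLevels ChainPlanar

variable {W : Type} [DecidableEq W] [Countable W] (X : SimpleGraph W) [X.LocallyFinite]

/-! ## §1 The standard first hop: planar data -/

/-- The planar centre of the root seed prism for direction `du`: signed level `20t - m - 1`, transverse coordinate `-3t`. [folklore] -/
def rootV (du : MDir) (t m : ℕ) : Site 2 := fun i => if i = du.1 then sgOf du * (20 * (t : ℤ) - m - 1) else -(3 * (t : ℤ))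

/-- The sign of `du` as a unit. [folklore] -/
def sgUnit (du : MDir) : ℤˣ := if sgOf du = 1 then 1 else -1

/-- The orthant of the landing piece: along the axis in direction `du`, `+1` across. [folklore] -/
def rootτ (du : MDir) : Fin 2 → ℤˣ := fun j => if j = du.1 then sgUnit du else 1

omit [DecidableEq W] [Countable W] in
/-- `↑(sgUnit du) = sgOf du`. [folklore] -/
theorem sgUnit_val (du : MDir) : (sgUnit du : ℤ) = sgOf du := by
  unfold sgUnit
  rcases sgOf_sign du with h | h
  · rw [if_pos h, h]; rfl
  · rw [if_neg (by rw [h]; norm_num), h]; rfl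

omit [DecidableEq W] [Countable W] in
/-- The centre along the axis. [folklore] -/
@[simp] theorem rootV_fst (du : MDir) (t m : ℕ) : rootV du t m du.1 = sgOf du * (20 * (t : ℤ) - m - 1) := by simp [rootV]

omit [DecidableEq W] [Countable W] in
/-- The centre across the axis. [folklore] -/
@[simp] theorem rootV_oth (du : MDir) (t m : ℕ) : rootV du t m (oth du.1) = -(3 * (t : ℤ)) := by simp [rootV, oth_ne]

omit [DecidableEq W] [Countable W] in
/-- **The standard root run is admissible**: `ca = 26t - m - 1`, `cb = 0`, `q' = 3t`. [folklore] -/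
theorem rootRunOK_std {C : PCells} {t R' ℓ₀ m : ℕ} (hr : (C.r : ℤ) = 4 * t) (hs : (R' : ℤ) + ℓ₀ ≤ t) (h100 : 100 * R' ≤ t)
    (hm : m + 47 * R' + 2 ≤ t) : RootRunOK C t R' ℓ₀ (26 * (t : ℤ) - m - 1) 0 (3 * (t : ℤ)) := by
  have h100' : 100 * (R' : ℤ) ≤ t := by exact_mod_cast h100
  have hm' : (m : ℤ) + 47 * R' + 2 ≤ t := by exact_mod_cast hm
  have hR0 : (0 : ℤ) ≤ R' := by positivity
  have hm0 : (0 : ℤ) ≤ m := by positivity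
  exact ⟨hr, hs, by linarith, by positivity, by linarith, by linarith, by linarith, by simp; linarith, by simp; linarith⟩

omit [DecidableEq W] [Countable W] in
/-- **The landing quarter-face of the first hop lies on the start row** of the standard root run. [folklore] -/
theorem root_piece_subset_core (du : MDir) (t m R' : ℕ) :
    (orthantFace du.1 (rootτ du) (6 * t)).image (fun s => s + rootV du t m) ⊆
      Adv.core 0 (3 * (t : ℤ)) (t : ℤ) R' du.1 (sgOf du) (rootCtr du (26 * (t : ℤ) - m - 1) 0) 0 := by
  intro z hz
  obtain ⟨s, hs, rfl⟩ := Finset.mem_image.1 hz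
  rw [mem_orthantFace, mem_box] at hs
  obtain ⟨hsb, hsa, hsj⟩ := hs
  have hτa : (rootτ du du.1 : ℤ) = sgOf du := by simp [rootτ, sgUnit_val]
  have hτb : (rootτ du (oth du.1) : ℤ) = 1 := by simp [rootτ, oth_ne]
  rw [hτa] at hsa
  have hsb' := hsj (oth du.1) (oth_ne du.1)
  rw [hτb, one_mul] at hsb'
  have hsbb := (hsb (oth du.1)).2
  have hσσ : sgOf du * sgOf du = 1 := by rcases sgOf_sign du with h | h <;> simp [h]
  rw [mem_rootCore_zero]
  refine ⟨?_, ?_, ?_⟩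
  · simp only [Pi.add_apply, rootV_fst]
    have : sgOf du * s du.1 = 6 * t := by exact_mod_cast hsa
    calc sgOf du * (s du.1 + sgOf du * (20 * (t : ℤ) - m - 1))
        = sgOf du * s du.1 + sgOf du * sgOf du * (20 * (t : ℤ) - m - 1) := by ring
      _ = 26 * (t : ℤ) - m - 1 := by rw [this, hσσ]; ring
  · simp only [Pi.add_apply, rootV_oth]; linarith
  · simp only [Pi.add_apply, rootV_oth]; push_cast at hsbb; linarith

omit [DecidableEq W] [Countable W] in
/-- **The seed prism's planar part lies in `C.Q 0`** (`r = 4t`, `m + 1 ≤ 17 t`). [folklore] -/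
theorem root_seed_planar_subset_Q {C : PCells} {t : ℕ} (hr : (C.r : ℤ) = 4 * t) (du : MDir) {m : ℕ} (hm : m + 1 ≤ 17 * t) :
    (box 2 m).image (fun s => s + rootV du t m) ⊆ C.Q 0 := by
  intro z hz
  obtain ⟨s, hs, rfl⟩ := Finset.mem_image.1 hz
  rw [mem_box] at hs
  have hm' : (m : ℤ) + 1 ≤ 17 * t := by exact_mod_cast hm
  rw [PCells.Q, PCells.mem_sq_iff]
  intro i
  simp only [cen_zero_apply]
  push_cast
  rw [hr]
  by_cases hi : i = du.1
  · subst hi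
    simp only [Pi.add_apply, rootV_fst]
    have := hs du.1
    rcases sgOf_sign du with h | h <;> rw [h] <;> constructor <;> linarith [this.1, this.2]
  · rw [eq_oth_of_ne hi]
    simp only [Pi.add_apply, rootV_oth]
    have := hs (oth du.1)
    constructor <;> linarith [this.1, this.2]

omit [DecidableEq W] [Countable W] in
/-- **The planar part of the first-hop prism (scale `6t`) lies in `C.Q 0 ∪ C.Btw 0 du`**, the `C.Q 0`-part at signed levels `≤ 20t` and the
rest at levels `21t … 26t`. [folklore] -/
theorem root_hop_planar {C : PCells} {t : ℕ} (hr : (C.r : ℤ) = 4 * t) (du : MDir) {m : ℕ} (hm : m + 1 ≤ 8 * t) (ht : 1 ≤ t) {z : Site 2}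
    (hz : z ∈ (box 2 (6 * t)).image (fun s => s + rootV du t m)) :
    z ∈ C.Q 0 ∨ z ∈ C.Btw 0 du := by
  obtain ⟨s, hs, rfl⟩ := Finset.mem_image.1 hz
  rw [mem_box] at hs
  have hm' : (m : ℤ) + 1 ≤ 8 * t := by exact_mod_cast hm
  have ht' : (1 : ℤ) ≤ t := by exact_mod_cast ht
  have hsa := hs du.1
  have hsb := hs (oth du.1)
  push_cast at hsa hsb
  have hσσ : sgOf du * sgOf du = 1 := by rcases sgOf_sign du with h | h <;> simp [h]
  -- the signed level of `s + v`
  have hlev : sgOf du * ((s + rootV du t m) du.1) = sgOf du * s du.1 + (20 * (t : ℤ) - m - 1) := by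
    simp only [Pi.add_apply, rootV_fst]
    calc sgOf du * (s du.1 + sgOf du * (20 * (t : ℤ) - m - 1))
        = sgOf du * s du.1 + sgOf du * sgOf du * (20 * (t : ℤ) - m - 1) := by ring
      _ = _ := by rw [hσσ, one_mul]
  have hsσ : -(6 * (t : ℤ)) ≤ sgOf du * s du.1 ∧ sgOf du * s du.1 ≤ 6 * t := by
    rcases sgOf_sign du with h | h <;> rw [h] <;> constructor <;> linarith [hsa.1, hsa.2]
  by_cases hL : sgOf du * ((s + rootV du t m) du.1) ≤ 20 * t
  · left
    rw [PCells.Q, PCells.mem_sq_iff]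
    intro i
    simp only [cen_zero_apply]
    push_cast
    rw [hr]
    by_cases hi : i = du.1
    · subst hi
      rw [hlev] at hL
      simp only [Pi.add_apply, rootV_fst]
      rcases sgOf_sign du with h | h
      · rw [h] at hL hsσ ⊢; simp only [one_mul] at hL hsσ ⊢; constructor <;> linarith [hsσ.1]
      · rw [h] at hL hsσ ⊢; constructor <;> linarith [hsσ.1, hsσ.2]
    · rw [eq_oth_of_ne hi]
      simp only [Pi.add_apply, rootV_oth]
      constructor <;> linarith [hsb.1, hsb.2]
  · right
    push Not at hL
    rw [PCells.Btw, PCells.mem_psBox_iff]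
    simp only [cen_zero_apply, sub_zero]
    rw [hr]
    refine ⟨⟨by linarith, ?_⟩, ?_, ?_⟩
    · rw [hlev]; linarith [hsσ.2]
    · simp only [Pi.add_apply, rootV_oth]; linarith [hsb.1]
    · simp only [Pi.add_apply, rootV_oth]; linarith [hsb.2]

/-! ## §2 The root residue for the schedule of record -/

/-- **THE ROOT RESIDUE OF THE CONCENTRIC SCHEME, SCHEDULE OF RECORD** (`Λ := concRadiiGB C gap gap' E₀ L'`, root tube `B(w₀, F 1 - L')`, standard
first hop of scale `6t`): `RootOblA` from constants, counts, inputs at the running parameter and the excess radius only.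
[cite: KozmaNitzan2024, §4 p. 27 (G₀), p. 28 ((32) at the root), Lemma 11 (pp. 22–23), Lemma 12 (p. 24)] -/
theorem rootOblA_concGB (C : PCells) (w₀ : W) (gap gap' : ℕ → ℕ) (E₀ L' : ℕ) (q : unitInterval) (δc : ℝ) {Δ' : ℕ} {δr : ℕ → ℝ}
    {t R' ℓ₀ Rlev N j₀ j₁ M : ℕ} (hr : C.r = 4 * t) (ht : 1 ≤ t) (hs : R' + ℓ₀ ≤ t) (h100 : 100 * R' ≤ t) (hMt : M + 47 * R' + 2 ≤ t)
    (hRl : Rlev + 1 ≤ R') (hj : j₁ ≤ Rlev) (hj₀ : M + 1 ≤ j₀) (hMℓ : M < ℓ₀)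
    (hcount : 1 / (1 - (q : ℝ)) ^ (Δ' * N) ≤ δr 44 * ((Finset.Icc j₀ j₁).card : ℝ))
    {Δ : ℕ} (hΔ : ∀ w, X.degree w ≤ Δ) {p₀ : unitInterval} (hT : TubeSubcritical X p₀) (V₀ : Finset W) (hfr : ∀ w : W, ∃ γ : X ≃g X, γ w ∈ V₀)
    (hδr : 0 < δr 44) (hδr1 : δr 44 ≤ 1) {msel : W → ℕ} (hmsel : ∀ τ ∈ V₀, msel τ ≤ M)
    (hstd : ∀ τ ∈ V₀,
      1 - δr 44 ^ 2 < (bondPercolation (X □ zdGraph 2) q).real (UniqZone.zone (X □ zdGraph 2) (ufatSeq X hT V₀ τ) (msel τ) M) ∧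
      ∀ g : HOct 2, 1 - δr 44 ^ 2 < (bondPercolation (X □ zdGraph 2) q).real
        (linkIn (↑(ufatSeq X hT V₀ τ M)) (ufatSeq X hT V₀ τ (msel τ)) (ballFin X τ (ufatRadius X hT V₀ M) ×ˢ piece g M)))
    (hlink : ∀ ℓ, ℓ₀ ≤ ℓ → ℓ ≤ t + R' → ∀ τ ∈ V₀, ∀ g : HOct 2, 1 - δr 44 ^ 2 < (bondPercolation (X □ zdGraph 2) q).real
      (linkIn (↑(ufatSeq X hT V₀ τ ℓ)) (ufatSeq X hT V₀ τ (msel τ)) (ballFin X τ (ufatRadius X hT V₀ ℓ) ×ˢ piece g ℓ)))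
    (hlink₆ : ∀ τ ∈ V₀, ∀ g : HOct 2, 1 - δr 44 ^ 2 < (bondPercolation (X □ zdGraph 2) q).real
      (linkIn (↑(ufatSeq X hT V₀ τ (6 * t))) (ufatSeq X hT V₀ τ (msel τ)) (ballFin X τ (ufatRadius X hT V₀ (6 * t)) ×ˢ piece g (6 * t))))
    (hψM : ufatRadius X hT V₀ M ≤ E₀) (hψ₆ : ufatRadius X hT V₀ (6 * t) ≤ E₀) (hE₀R : E₀ ≤ Frad gap gap' E₀ 1 - L')
    (hLψ : ufatRadius X hT V₀ (t + R') + ufatRadius X hT V₀ M ≤ L') (hLR : L' ≤ Frad gap gap' E₀ 1 - L')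
    (kk : ℕ) (hN : kk * kitB Δ M (ufatRadius X hT V₀ M) ≤ N) (hk : (1 - (q : ℝ) ^ kitSB Δ M (ufatRadius X hT V₀ M)) ^ kk ≤ δr 44)
    {η : ℝ} (hη : η ≤ δr 44 / 2) {R₁ : ℕ}
    (hR₁ : ∀ R'', R₁ ≤ R'' → ∀ τ ∈ ({w₀} : Finset W), ∀ (Rw : ℕ) (D' A' : Finset (W × Site 2)),
      D' ⊆ ballFin X τ Rw ×ˢ box 2 (25 * C.r) → A' ⊆ D' → (∀ a ∈ A', a.1 ∈ ballFin X τ (E₀ + 1)) →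
      (bondPercolation (X □ zdGraph 2) q).real (excess X τ R'' D' A') ≤ η)
    (hR : R₁ ≤ Frad gap gap' E₀ 1 - L' - L') :
    KSchA.RootOblA X (concSchemeG X C w₀ (concRadiiGB C gap gap' E₀ L') q δc) Δ' δr := by
  obtain ⟨γ, hγ⟩ := hfr w₀
  set m := msel (γ w₀) with hm
  have hmM : m ≤ M := hmsel _ hγ
  set Rt := Frad gap gap' E₀ 1 - L' with hRt
  have hr' : (C.r : ℤ) = 4 * t := by exact_mod_cast hr
  have hs' : (R' : ℤ) + ℓ₀ ≤ t := by exact_mod_cast hs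
  have hrad := fun du => root_radii_concRadiiGB C gap gap' E₀ L' du
  have hQ0E : (concRadiiGB C gap gap' E₀ L').rQ 0 0 = E₀ := by
    rw [concRadiiGB_rQ]
    have : nQ 0 (0 : Site 2) = 0 := by rw [nQ, if_pos rfl, gen0_zero]
    rw [this, Erad_zero]
  refine rootOblA_concG_raw X C w₀ (concRadiiGB C gap gap' E₀ L') q δc (Rt := Rt) (L' := L') (t := t) (R' := R') (ℓ₀ := ℓ₀)
    (E₀ := E₀) (ℓR := 6 * t) (ca := fun _ => 26 * (t : ℤ) - m - 1) (cb := fun _ => 0) (q' := fun _ => 3 * (t : ℤ))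
    (fun du => rootRunOK_std hr' hs' h100 (by omega)) hRl hj (fun du => (hrad du).1) (fun du => (hrad du).2.1)
    (fun du => (hrad du).2.2.1) (le_of_eq hQ0E) hE₀R hcount hΔ hT V₀ hfr hδr hδr1 hmsel hstd hMℓ hlink hlink₆
    (hψM.trans hE₀R) hLψ hLR (hψ₆.trans hE₀R) hj₀ kk hN hk hη hR₁ hR γ hγ (fun du => rootV du t m) (fun du => rootτ du)
    (fun du => ?_) (fun du => ?_) (fun du => root_piece_subset_core du t m R')
  · -- the seed prism lies in the wired root cube
    rw [frameSeq_eq_product]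
    change _ ⊆ ballFin X w₀ ((concRadiiGB C gap gap' E₀ L').rQ 0 0) ×ˢ C.Q 0
    rw [hQ0E]
    exact Finset.product_subset_product (ballFin_mono X w₀ ((ufatRadius_mono X hT V₀ hmM).trans hψM))
      (root_seed_planar_subset_Q hr' du (by omega))
  · -- the first-hop prism lies in the cut root world
    rw [frameSeq_eq_product]
    intro z hz
    obtain ⟨hz1, hz2⟩ := Finset.mem_product.1 hz
    have hz1R : z.1 ∈ ballFin X w₀ Rt := ballFin_mono X w₀ (hψ₆.trans hE₀R) hz1
    refine Finset.mem_filter.2 ⟨?_, hz1R⟩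
    rcases root_hop_planar hr' du (by omega) ht hz2 with hQ | hB
    · refine Finset.mem_union_left _ ?_
      change z ∈ ballFin X w₀ ((concRadiiGB C gap gap' E₀ L').rQ 0 0) ×ˢ C.Q 0
      rw [hQ0E]
      exact Finset.mem_product.2 ⟨ballFin_mono X w₀ hψ₆ hz1, hQ⟩
    · refine Finset.mem_union_right _ (Finset.mem_union_left _ ?_)
      change z ∈ ballFin X w₀ ((concRadiiGB C gap gap' E₀ L').rB 0 0 du) ×ˢ C.Btw 0 du
      exact Finset.mem_product.2 ⟨ballFin_mono X w₀ (hrad du).1 hz1R, hB⟩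

end BoxProdZ2

end Transplant

end Summit.CriticalPhenomena.PercolationContinuityZ3.Theorems

end
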